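import Mathlib
import HarnessLib
import Summits.Langlands.Statement
import Summits.Langlands.Langlands.Theses.SkinnerWilesDefectOne
import Summits.Langlands.Langlands.Theses.SymmetryTypeSplit
import Literature.NumberTheory.Automorphic.CaraianiNewtonModularity
import Summits.Langlands.Langlands.Theses.EllipticTraceSplit
set_option linter.dupNamespace false
set_option linter.unusedVariables false
set_option linter.unusedSectionVars false

/-!
# Birth skeleton (BC3) for crux `EllipticTraceSplit.NonEllipticGenericProModular` — line `birth` (AFTER-BIRTH form: the route decl BY NAME)

Node `EllipticTraceSplit` (decomp-langlands lens-2 g19; child route refining `SymmetryTypeSplit:GenericProModular` stmt-Langlands-27289).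
Shape: stubs `theorem stub_<name> : <signature> := by sorry` (each a genuine piece — no stub restates the cell, GEN, E or the summit: probes
`probes_stubs_NonEllipticGenericProModular.lean`), `namespace _Goal` naming each stub statement, and the kernel-checked composition
`NonEllipticGenericProModular_of (h₁ : _Goal.stub_…) … : <the crux BY NAME>`.  `lean check --json`: rc 0, sorries = the stubs (2), none elsewhere.
-/

namespace Summit.Langlands.Langlands.Cruxes.NonEllipticGenericProModular.Birth

open scoped NumberField
open Filter IsDedekindDomain Literature.NumberTheory.GaloisRepresentations Literature.NumberTheory.Automorphic

/-- stub · `stub_infiniteX0FifteenElliptic` — NEL ∩ «ρ = ν ⊗ ρ₁ twisted-elliptic (ν finite order; ρ₁ ↔ a non-CM Weierstrass model over 𝓞 F, Δ ≠ 0, charpolys a.e.) but X₀(15)(F) INFINITE» — exactly the case Caraiani–Newton 2023 leave open (p. 2–3; needs the images of X₀(15)(F) in the 3- and 5-adic pictures).  Named open problem, strictly weaker than NEL.  Size: open (L). -/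
theorem stub_infiniteX0FifteenElliptic :
    ∀ (F : Type) [Field F] [NumberField F], NumberField.IsTotallyComplex F → Module.finrank ℚ F = 2 → ∀ (p : ℕ) [Fact p.Prime], p ≠ 2 → ∀ (O : ValuationSubring (PadicAlgCl p)), O = (Valued.v : Valuation (PadicAlgCl p) NNReal).valuationSubring → ∀ (ρ : Literature.NumberTheory.GaloisRepresentations.FramedGaloisRep F (PadicAlgCl p) 2) (ρ₀ : Field.absoluteGaloisGroup F →* Matrix.GeneralLinearGroup (Fin 2) O), ρ.toGaloisRep.IsIrreducible → (∀ᶠ v in cofinite, ρ.IsUnramifiedAt v) → ρ.HasUpperTriangularIntegralModel ρ₀ → (∃ k : ℕ, 2 ≤ k ∧ ∃ m : ℕ, 0 < m ∧ ∀ v : IsDedekindDomain.HeightOneSpectrum (NumberField.RingOfIntegers F), (p : NumberField.RingOfIntegers F) ∈ v.asIdeal → Literature.NumberTheory.GaloisRepresentations.IsPDistinguishedAt ρ₀ v ∧ ∃ Q : Matrix.GeneralLinearGroup (Fin 2) (PadicAlgCl p), Valued.v (Q.val 0 0) ≤ Valued.v (Q.val 1 0) ∧ ∀ σ, (Q⁻¹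 * ρ.toLocal v σ * Q).val 1 0 = 0 ∧ (σ ∈ Literature.NumberTheory.GaloisRepresentations.absInertia (v.adicCompletion F) → (Q⁻¹ * ρ.toLocal v σ * Q).val 1 1 ^ m = 1 ∧ (Q⁻¹ * ρ.toLocal v σ * Q).val 0 0 ^ m = algebraMap (Padic p) (PadicAlgCl p) (((Literature.NumberTheory.GaloisRepresentations.GaloisRep.cyclotomicCharacter (v.adicCompletion F) p σ).val : PadicInt p) : Padic p) ^ ((k - 1) * m))) → ¬ (∃ (η : Field.absoluteGaloisGroup F →ₜ* (PadicAlgCl p)ˣ) (P : Matrix.GeneralLinearGroup (Fin 2) (PadicAlgCl p)), (∃ σ : Field.absoluteGaloisGroup F, η σ ≠ 1) ∧ ∀ σ : Field.absoluteGaloisGroup F, ((η σ : (PadicAlgCl p)ˣ) : PadicAlgCl p) • (ρ σ).val = (P * ρ σ * P⁻¹).val) → ¬ (∃ (ρ' : Literature.NumberTheory.GaloisRepresentations.FramedGaloisRep ℚ (PadicAlgCl p) 2) (ν : Field.absoluteGaloisGroup F →ₜ* (PadicAlgCl p)ˣ), ρ'.IsOdd ∧ (∃ n : ℕ, 0 <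 n ∧ ∀ σ, ν σ ^ n = 1) ∧ ∀ σ : Field.absoluteGaloisGroup F, (ρ σ).val = ((ν σ : (PadicAlgCl p)ˣ) : PadicAlgCl p) • (ρ' (Literature.NumberTheory.GaloisRepresentations.absGaloisRestrict ℚ F σ)).val) → ¬ Finite (Literature.NumberTheory.Automorphic.X0FifteenLegendre.baseChange F).toAffine.Point → (∃ (E : WeierstrassCurve (NumberField.RingOfIntegers F)) (ν : Field.absoluteGaloisGroup F →ₜ* (PadicAlgCl p)ˣ) (ρ₁ : Literature.NumberTheory.GaloisRepresentations.FramedGaloisRep F (PadicAlgCl p) 2), E.Δ ≠ 0 ∧ ¬ (E.baseChange F).HasCM ∧ (∃ n : ℕ, 0 < n ∧ ∀ σ, ν σ ^ n = 1) ∧ (∀ᶠ w : IsDedekindDomain.HeightOneSpectrum (NumberField.RingOfIntegers F) in Filter.cofinite, ρ₁.HasFrobCharpolyAt w (Polynomial.X ^ 2 - Polynomial.C ((Literature.NumberTheory.Automorphic.frobTraceAt E w : ℤ) : PadicAlgCl p) * Polynomial.X + Polynomial.C ((w.residueCard : ℕ) : PadicAlgCl p))) ∧ ∀ σ : Field.absoluteGaloisGroup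 F, (ρ σ).val = ((ν σ : (PadicAlgCl p)ˣ) : PadicAlgCl p) • (ρ₁ σ).val) → ∃ 𝒰 : Literature.NumberTheory.Automorphic.BigHeckeGLn.TameLevel 2 F p, 𝒰.IsPadicallyAutomorphic ρ := by
  sorry

/-- stub · `stub_nonEllipticTrace` — NEL ∩ «ρ is NO finite-order twist of a ρ₁ matching a non-CM Weierstrass model over 𝓞 F» (irrational Frobenius field / parallel weight k ≥ 3 / …): the RESIDUAL PROPER of GEN — no engine in print (F-g19.1: Berger–Klosin is the mixed type, outside the sector; barrier `ResiduallyReducibleBarrier`).  Size: open problem. -/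
theorem stub_nonEllipticTrace :
    ∀ (F : Type) [Field F] [NumberField F], NumberField.IsTotallyComplex F → Module.finrank ℚ F = 2 → ∀ (p : ℕ) [Fact p.Prime], p ≠ 2 → ∀ (O : ValuationSubring (PadicAlgCl p)), O = (Valued.v : Valuation (PadicAlgCl p) NNReal).valuationSubring → ∀ (ρ : Literature.NumberTheory.GaloisRepresentations.FramedGaloisRep F (PadicAlgCl p) 2) (ρ₀ : Field.absoluteGaloisGroup F →* Matrix.GeneralLinearGroup (Fin 2) O), ρ.toGaloisRep.IsIrreducible → (∀ᶠ v in cofinite, ρ.IsUnramifiedAt v) → ρ.HasUpperTriangularIntegralModel ρ₀ → (∃ k : ℕ, 2 ≤ k ∧ ∃ m : ℕ, 0 < m ∧ ∀ v : IsDedekindDomain.HeightOneSpectrum (NumberField.RingOfIntegers F), (p : NumberField.RingOfIntegers F) ∈ v.asIdeal → Literature.NumberTheory.GaloisRepresentations.IsPDistinguishedAt ρ₀ v ∧ ∃ Q : Matrix.GeneralLinearGroup (Fin 2) (PadicAlgCl p), Valued.v (Q.val 0 0) ≤ Valued.v (Q.val 1 0) ∧ ∀ σ, (Q⁻¹ *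 ρ.toLocal v σ * Q).val 1 0 = 0 ∧ (σ ∈ Literature.NumberTheory.GaloisRepresentations.absInertia (v.adicCompletion F) → (Q⁻¹ * ρ.toLocal v σ * Q).val 1 1 ^ m = 1 ∧ (Q⁻¹ * ρ.toLocal v σ * Q).val 0 0 ^ m = algebraMap (Padic p) (PadicAlgCl p) (((Literature.NumberTheory.GaloisRepresentations.GaloisRep.cyclotomicCharacter (v.adicCompletion F) p σ).val : PadicInt p) : Padic p) ^ ((k - 1) * m))) → ¬ (∃ (η : Field.absoluteGaloisGroup F →ₜ* (PadicAlgCl p)ˣ) (P : Matrix.GeneralLinearGroup (Fin 2) (PadicAlgCl p)), (∃ σ : Field.absoluteGaloisGroup F, η σ ≠ 1) ∧ ∀ σ : Field.absoluteGaloisGroup F, ((η σ : (PadicAlgCl p)ˣ) : PadicAlgCl p) • (ρ σ).val = (P * ρ σ * P⁻¹).val) → ¬ (∃ (ρ' : Literature.NumberTheory.GaloisRepresentations.FramedGaloisRep ℚ (PadicAlgCl p) 2) (ν : Field.absoluteGaloisGroup F →ₜ* (PadicAlgCl p)ˣ), ρ'.IsOdd ∧ (∃ n : ℕ, 0 < n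 ∧ ∀ σ, ν σ ^ n = 1) ∧ ∀ σ : Field.absoluteGaloisGroup F, (ρ σ).val = ((ν σ : (PadicAlgCl p)ˣ) : PadicAlgCl p) • (ρ' (Literature.NumberTheory.GaloisRepresentations.absGaloisRestrict ℚ F σ)).val) → ¬ (∃ (E : WeierstrassCurve (NumberField.RingOfIntegers F)) (ν : Field.absoluteGaloisGroup F →ₜ* (PadicAlgCl p)ˣ) (ρ₁ : Literature.NumberTheory.GaloisRepresentations.FramedGaloisRep F (PadicAlgCl p) 2), E.Δ ≠ 0 ∧ ¬ (E.baseChange F).HasCM ∧ (∃ n : ℕ, 0 < n ∧ ∀ σ, ν σ ^ n = 1) ∧ (∀ᶠ w : IsDedekindDomain.HeightOneSpectrum (NumberField.RingOfIntegers F) in Filter.cofinite, ρ₁.HasFrobCharpolyAt w (Polynomial.X ^ 2 - Polynomial.C ((Literature.NumberTheory.Automorphic.frobTraceAt E w : ℤ) : PadicAlgCl p) * Polynomial.X + Polynomial.C ((w.residueCard : ℕ) : PadicAlgCl p))) ∧ ∀ σ : Field.absoluteGaloisGroup F, (ρ σ).val = ((ν σ : (PadicAlgCl p)ˣ) : PadicAlgCl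 p) • (ρ₁ σ).val) → ∃ 𝒰 : Literature.NumberTheory.Automorphic.BigHeckeGLn.TameLevel 2 F p, 𝒰.IsPadicallyAutomorphic ρ := by
  sorry

namespace _Goal

/-- the statement of `stub_infiniteX0FifteenElliptic` as a named Prop. -/
def stub_infiniteX0FifteenElliptic : Prop :=
  type_of% @Summit.Langlands.Langlands.Cruxes.NonEllipticGenericProModular.Birth.stub_infiniteX0FifteenElliptic

/-- the statement of `stub_nonEllipticTrace` as a named Prop. -/
def stub_nonEllipticTrace : Prop :=
  type_of% @Summit.Langlands.Langlands.Cruxes.NonEllipticGenericProModular.Birth.stub_nonEllipticTrace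

end _Goal

/-- **`NonEllipticGenericProModular` from the 2 stubs** (kernel-checked, no sorry). -/
theorem NonEllipticGenericProModular_of (h1 : _Goal.stub_infiniteX0FifteenElliptic) (h2 : _Goal.stub_nonEllipticTrace) :
    Summit.Langlands.Langlands.Theses.EllipticTraceSplit.NonEllipticGenericProModular := by
  have ha : type_of% @stub_infiniteX0FifteenElliptic := h1
  have hb2 : type_of% @stub_nonEllipticTrace := h2
  intro F _ _ hF hd p _ hp O hO ρ ρ₀ hirr hunr hint hord hns hno hnb
  by_cases hc : (∃ (E : WeierstrassCurve (NumberField.RingOfIntegers F)) (ν : Field.absoluteGaloisGroup F →ₜ* (PadicAlgCl p)ˣ) (ρ₁ : Literature.NumberTheory.GaloisRepresentations.FramedGaloisRep F (PadicAlgCl p) 2), E.Δ ≠ 0 ∧ ¬ (E.baseChange F).HasCM ∧ (∃ n : ℕ, 0 < n ∧ ∀ σ, ν σ ^ n = 1) ∧ (∀ᶠ w : IsDedekindDomain.HeightOneSpectrum (NumberField.RingOfIntegers F) in Filter.cofinite, ρ₁.HasFrobCharpolyAt w (Polynomial.X ^ 2 - Polynomial.C ((Literature.NumberTheory.Automorphic.frobTraceAt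 E w : ℤ) : PadicAlgCl p) * Polynomial.X + Polynomial.C ((w.residueCard : ℕ) : PadicAlgCl p))) ∧ ∀ σ : Field.absoluteGaloisGroup F, (ρ σ).val = ((ν σ : (PadicAlgCl p)ˣ) : PadicAlgCl p) • (ρ₁ σ).val)
  · have hnf : ¬ Finite (Literature.NumberTheory.Automorphic.X0FifteenLegendre.baseChange F).toAffine.Point := fun hf => hnb ⟨hf, hc⟩
    exact ha F hF hd p hp O hO ρ ρ₀ hirr hunr hint hord hns hno hnf hc
  · exact hb2 F hF hd p hp O hO ρ ρ₀ hirr hunr hint hord hns hno hc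

/-- by-name sanity (an `example`): the stubs feed the composition as they stand. -/
example : Summit.Langlands.Langlands.Theses.EllipticTraceSplit.NonEllipticGenericProModular :=
  NonEllipticGenericProModular_of stub_infiniteX0FifteenElliptic stub_nonEllipticTrace

/-- hypothesis-free assembly (inherits the stubs' `sorry`, nothing else). -/
theorem NonEllipticGenericProModular_proof : Summit.Langlands.Langlands.Theses.EllipticTraceSplit.NonEllipticGenericProModular :=
  NonEllipticGenericProModular_of stub_infiniteX0FifteenElliptic stub_nonEllipticTrace

end Summit.Langlands.Langlands.Cruxes.NonEllipticGenericProModular.Birth
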